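import Literature.IUT.HodgeArakelov.CohomologyAutFunctoriality
import Literature.IUT.HodgeArakelov.EtaleThetaDataOfSetting
import Literature.AnabelianGeometry.EtaleTheta.ContH1ConjAction
import Literature.AnabelianGeometry.EtaleTheta.ContH1Lemmas

/-!
# [IUTchII] Prop 2.2 (ii)′ at the model: `ι` REVERSES the translates of the root class (fifth proof-only companion)

Proof-only companion (abc-iut cell, D-0067 wave 4, cone of [IUTchIII] Cor. 3.12; node **IUTchII:Prop2.2(ii)**; no
definitions). S. Mochizuki, *Inter-universal Teichmüller theory II*, kurims manuscript (Dec. 2020) §2, Prop. 2.2 (ii)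
p. 66, Rmk. 2.1.1 (i)(ii) p. 65 ("the vertex labeled `0` is fixed by `ι_X`"; `ι` reverses the `ℤ`-torsor of
irreducible components); [EtTh] Prop. 1.4 (ii) p. 20 ("`Θ̈(Ü) = −Θ̈(Ü⁻¹)`", "`Θ̈(−Ü) = −Θ̈(Ü)`"). Claim key of the
[IUTchII] interface `Mochizuki2012` (DISPUTED, D-0012). Nothing here takes a side on [IUTchIII] Cor. 3.12.

`ThetaEvaluationSettingModelProofs.lean` reduces the repaired `Prop22_ii'` at the model `D := etaleThetaDataOfSetting'`
to: the `ι`-action `(ρ, ρlim)` (abc-iut-L6-t1 `CohomologyAutFunctoriality`: `h1TopAut`/`h1LimAut` for an automorphism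
PAIR `(α, β)`), the class-level sign of `ε` (`hsign`), `hrev` ("`ι` carries the `γⁿ`-conjugate of the root class to
the `γ⁻ⁿ`-conjugate up to torsion") and `hfree`. THIS FILE derives `hrev` at the model from inputs about the
AUTOMORPHISM PAIR only:

* the NATURALITY of L6-t1's transport `autMap` with respect to L2's conjugation action —
  `autMap (conj σ x) = conj (α σ) (autMap x)` — is L6-t1's `ContH1Aut.autMap_conj`
  (`CohomologyAutFunctoriality.lean` v2, consumed BY NAME);
* `conj_rootLiftClass_of_mem_GtpY` — an element of `Π^tp_Y̲̲` moves the root class by a class of finite order, given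
  the class-level sign `hsign` of `ε ∈ Π^tp_Y̲̲ ∖ Π^tp_Ÿ̲̲` (`Π^tp_Ÿ̲̲` acts trivially, L2-t1 `ContH1.conj_eq_self_of_mem`;
  `[Π^tp_Y̲̲ : Π^tp_Ÿ̲̲] = 2`, L2-t8 `relIndex_GtpYdd_inf`);
* `iota_reverses_translates` — for an automorphism pair `(α, β)` of `(Π^tp_X̲̲, (Π^tp_X)^Θ)` stabilising `Π^tp_Ÿ̲̲` with
  **`toLZ (α γ) = −1`** ("`ι` reverses the `ℤ`-torsor", Rmk. 2.1.1 (i)) and moving the root class by a class of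
  finite order (`hιsign`: [EtTh] Prop. 1.4 (ii) at the class level, "`Θ̈(Ü) = −Θ̈(Ü⁻¹)`"), the transport
  `ρ₀ := h1TopAut` satisfies: `ρ₀(γⁿ·η̲̈) · (γ⁻ⁿ·η̲̈)⁻¹` has finite order for every `n ∈ ℤ`;
* `hrev_of_transport` — the additive form consumed by `prop22_ii'_of_translates` /
  `prop22_ii'_etaleThetaDataOfSetting`, for any `ρ` on `coh.H1 ⊤` intertwining `ρ₀` through `h1Top`.

So, at the model, hypothesis `hrev` of G-w4d010-2 is REDUCED to `toLZ (α γ) = −1` plus the class-level signs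
(plan/GAP-LEDGER.md (P14ii-cl)); no new named fact.
-/

namespace Literature.IUT.HodgeArakelov

open Literature.AnabelianGeometry.EtaleTheta (ContH1)


noncomputable section

/-! ## At the model `Π := Π^tp_X̲̲`: `ι` reverses the translates of the root class -/

open EtaleThetaDataOfSetting

variable {p : ℕ} [Fact p.Prime] {D : Literature.AnabelianGeometry.EtaleTheta.ThetaSetting p}
  {E : D.EtaleThetaData} {l : ℕ} (C : E.DoubleUnderline l) [hN : (PiYdd C).Normal]

/-- An element `y` of `Π^tp_Y̲̲ = Ker(toLZ)` moves the root class `η̲̈^Θ` by a class of FINITE ORDER, given the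
class-level sign of one `ε ∈ Π^tp_Y̲̲ ∖ Π^tp_Ÿ̲̲` (`hsign`: `ε·η̲̈ = η̲̈·κ`, `κ² = 1` — [EtTh] Prop. 1.4 (ii) at the class
level): either `y ∈ Π^tp_Ÿ̲̲` acts trivially (L2-t1 `ContH1.conj_eq_self_of_mem`) or `y ∈ ε·Π^tp_Ÿ̲̲`
(`[Π^tp_Y̲̲ : Π^tp_Ÿ̲̲] = 2`, L2-t8 `relIndex_GtpYdd_inf`) and `y·η̲̈ = η̲̈·κ`. [cite: MochizukiEtTh2009, Def 2.7 p.41] -/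
theorem conj_rootLiftClass_of_mem_GtpY (hS : D.Sec2Hyps) (ε : Pi C) (hε₁ : (ε : D.PiTemp) ∈ D.GtpY)
    (hε₂ : (ε : D.PiTemp) ∉ D.GtpYdd)
    (hsign : ∃ κ : ContH1 (phi C) (D.lDeltaTheta l) (PiYdd C ⊓ ⊤), κ ^ 2 = 1 ∧
      ContH1.conj (phi C) (D.lDeltaTheta l) ε (rootLiftClass C) = rootLiftClass C * κ)
    (y : Pi C) (hy : (y : D.PiTemp) ∈ D.GtpY) :
    ∃ t : ContH1 (phi C) (D.lDeltaTheta l) (PiYdd C ⊓ ⊤), IsOfFinOrder t ∧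
      ContH1.conj (phi C) (D.lDeltaTheta l) y (rootLiftClass C) = rootLiftClass C * t := by
  by_cases hyYdd : (y : D.PiTemp) ∈ D.GtpYdd
  · refine ⟨1, IsOfFinOrder.one, ?_⟩
    rw [mul_one]
    exact ContH1.conj_eq_self_of_mem _ (Subgroup.mem_inf.mpr
      ⟨Subgroup.mem_subgroupOf.mpr (Subgroup.mem_inf.mpr ⟨hyYdd, y.2⟩), Subgroup.mem_top _⟩) _
  · obtain ⟨κ, hκ2, hκ⟩ := hsign
    have h2 : (D.GtpYdd.subgroupOf (C.Huu ⊓ D.GtpY)).index = 2 := C.relIndex_GtpYdd_inf hS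
    let aε : ↥(C.Huu ⊓ D.GtpY) := ⟨(ε : D.PiTemp), Subgroup.mem_inf.mpr ⟨ε.2, hε₁⟩⟩
    let ay : ↥(C.Huu ⊓ D.GtpY) := ⟨(y : D.PiTemp), Subgroup.mem_inf.mpr ⟨y.2, hy⟩⟩
    have hprod : aε⁻¹ * ay ∈ D.GtpYdd.subgroupOf (C.Huu ⊓ D.GtpY) := by
      rw [Subgroup.mul_mem_iff_of_index_two h2, inv_mem_iff, Subgroup.mem_subgroupOf,
        Subgroup.mem_subgroupOf]
      exact ⟨fun h => absurd h hε₂, fun h => absurd h hyYdd⟩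
    rw [Subgroup.mem_subgroupOf] at hprod
    have hy' : ε⁻¹ * y ∈ PiYdd C ⊓ ⊤ :=
      Subgroup.mem_inf.mpr ⟨Subgroup.mem_subgroupOf.mpr (Subgroup.mem_inf.mpr ⟨hprod, (ε⁻¹ * y).2⟩),
        Subgroup.mem_top _⟩
    refine ⟨κ, isOfFinOrder_iff_pow_eq_one.mpr ⟨2, two_pos, hκ2⟩, ?_⟩
    have hyε : y = ε * (ε⁻¹ * y) := (mul_inv_cancel_left ε y).symm
    conv_lhs => rw [hyε, ContH1.conj_mul_apply, ContH1.conj_eq_self_of_mem _ hy']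
    exact hκ

/-- **`ι` reverses the translates of the root class, up to torsion** ([IUTchII] Rmk. 2.1.1 (i)(ii) p. 65 / Prop. 2.2
(ii) p. 66 over [EtTh] Prop. 1.4 (ii) p. 20), at the model `Π := Π^tp_X̲̲`: for an automorphism pair `(α, β)` of
`(Π^tp_X̲̲, (Π^tp_X)^Θ)` compatible with `φ` and the coefficients `l·Δ_Θ`, stabilising `Π^tp_Ÿ̲̲` (`hH`), REVERSING
the `ℤ`-torsor (`hαγ : toLZ (α γ) = −1` for the `toLZ`-generator `γ`) and moving the root class by a class of
finite order (`hιsign` — the class of `−1`, "`Θ̈(Ü) = −Θ̈(Ü⁻¹)`"), and given the class-level sign of `ε` (`hsign`),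
the transport `ρ₀ := h1TopAut` (abc-iut-L6-t1) satisfies: `ρ₀(γⁿ·η̲̈)·(γ⁻ⁿ·η̲̈)⁻¹` has finite order for all `n ∈ ℤ`.
PROOF: naturality `ρ₀(γⁿ·η̲̈) = (αγ)ⁿ·ρ₀(η̲̈)` (L6-t1 `ContH1Aut.autMap_conj`), `(αγ)ⁿ ∈ γ⁻ⁿ·Π^tp_Y̲̲` (`toLZ`), and
`conj_rootLiftClass_of_mem_GtpY`. [claim: Mochizuki2012, status: disputed]
(IUTchII §2 Prop 2.2 (ii), kurims pp.65-66) -/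
theorem iota_reverses_translates (hS : D.Sec2Hyps) (γ ε : Pi C) (hγ : C.toLZ γ = Multiplicative.ofAdd 1)
    (hε₁ : (ε : D.PiTemp) ∈ D.GtpY) (hε₂ : (ε : D.PiTemp) ∉ D.GtpYdd)
    (hsign : ∃ κ : ContH1 (phi C) (D.lDeltaTheta l) (PiYdd C ⊓ ⊤), κ ^ 2 = 1 ∧
      ContH1.conj (phi C) (D.lDeltaTheta l) ε (rootLiftClass C) = rootLiftClass C * κ)
    (α : (Pi C) ≃ₜ* (Pi C)) (β : D.GtpTheta ≃ₜ* D.GtpTheta) (hφ : ∀ g, β (phi C g) = phi C (α g))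
    (hA : ∀ a : D.GtpTheta, a ∈ D.lDeltaTheta l → β a ∈ D.lDeltaTheta l)
    (hH : ∀ x, x ∈ PiYdd C ↔ α x ∈ PiYdd C)
    (hαγ : C.toLZ (α γ) = Multiplicative.ofAdd (-1))
    (hιsign : ∃ κ' : ContH1 (phi C) (D.lDeltaTheta l) (PiYdd C ⊓ ⊤), IsOfFinOrder κ' ∧
      h1TopAut (phi C) (D.lDeltaTheta l) (PiYdd C) α β hφ hA hH (rootLiftClass C) = rootLiftClass C * κ')
    (n : ℤ) :
    IsOfFinOrder (h1TopAut (phi C) (D.lDeltaTheta l) (PiYdd C) α β hφ hA hH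
        (ContH1.conj (phi C) (D.lDeltaTheta l) (γ ^ n) (rootLiftClass C)) *
      (ContH1.conj (phi C) (D.lDeltaTheta l) (γ ^ (-n)) (rootLiftClass C))⁻¹) := by
  obtain ⟨κ', hκ'fin, hκ'⟩ := hιsign
  -- naturality: `ρ₀(γⁿ·η) = (α γ)ⁿ · ρ₀(η)`
  have hnat : h1TopAut (phi C) (D.lDeltaTheta l) (PiYdd C) α β hφ hA hH
        (ContH1.conj (phi C) (D.lDeltaTheta l) (γ ^ n) (rootLiftClass C)) =
      ContH1.conj (phi C) (D.lDeltaTheta l) (α γ ^ n) (rootLiftClass C * κ') := by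
    rw [← hκ', ← map_zpow]
    exact ContH1Aut.autMap_conj (phi C) (D.lDeltaTheta l) α β hφ hA _ (γ ^ n) (rootLiftClass C)
  -- `(α γ)ⁿ = γ⁻ⁿ · y` with `y := γⁿ (αγ)ⁿ ∈ Π^tp_Y̲̲`
  have hyY : (((γ ^ n * α γ ^ n : Pi C)) : D.PiTemp) ∈ D.GtpY := by
    have hker : γ ^ n * α γ ^ n ∈ C.toLZ.ker := by
      rw [MonoidHom.mem_ker, map_mul, map_zpow, map_zpow, hγ, hαγ, ← ofAdd_zsmul, ← ofAdd_zsmul,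
        ← ofAdd_add, smul_eq_mul, smul_eq_mul, mul_one, mul_neg, mul_one, add_neg_cancel, ofAdd_zero]
    rw [C.toLZ_ker, Subgroup.mem_subgroupOf] at hker
    exact hker
  obtain ⟨t, htfin, ht⟩ := conj_rootLiftClass_of_mem_GtpY C hS ε hε₁ hε₂ hsign (γ ^ n * α γ ^ n) hyY
  have hsplit : α γ ^ n = γ ^ (-n) * (γ ^ n * α γ ^ n) := by rw [zpow_neg, inv_mul_cancel_left]
  have cancel : ∀ a b c : ContH1 (phi C) (D.lDeltaTheta l) (PiYdd C ⊓ ⊤), a * b * c * a⁻¹ = b * c :=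
    fun a b c => by rw [mul_right_comm (a * b) c a⁻¹, mul_right_comm a b a⁻¹, mul_inv_cancel, one_mul]
  rw [hnat, hsplit, ContH1.conj_mul_apply, map_mul, ht, map_mul, map_mul, cancel]
  exact ((ContH1.conj (phi C) (D.lDeltaTheta l) (γ ^ (-n))).isOfFinOrder htfin).mul
    ((ContH1.conj (phi C) (D.lDeltaTheta l) (γ ^ (-n))).isOfFinOrder
      ((ContH1.conj (phi C) (D.lDeltaTheta l) (γ ^ n * α γ ^ n)).isOfFinOrder hκ'fin))

/-- **`hrev` of `prop22_ii'_of_translates` at the model**, in the additive shape it consumes: for any additive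
automorphism `ρ` of `coh.H1 ⊤` that intertwines the transport `ρ₀ := h1TopAut` through the comparison `h1Top`
(`hρT` — this is how abc-iut-L6-t1's `ρ` is built), `ρ (γⁿ-translate) − (γ⁻ⁿ-translate)` has finite additive order
for every `n`. [claim: Mochizuki2012, status: disputed] (IUTchII §2 Prop 2.2 (ii), kurims pp.65-66) -/
theorem hrev_of_transport (hS : D.Sec2Hyps) (γ ε : Pi C) (hγ : C.toLZ γ = Multiplicative.ofAdd 1)
    (hε₁ : (ε : D.PiTemp) ∈ D.GtpY) (hε₂ : (ε : D.PiTemp) ∉ D.GtpYdd)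
    (hsign : ∃ κ : ContH1 (phi C) (D.lDeltaTheta l) (PiYdd C ⊓ ⊤), κ ^ 2 = 1 ∧
      ContH1.conj (phi C) (D.lDeltaTheta l) ε (rootLiftClass C) = rootLiftClass C * κ)
    (α : (Pi C) ≃ₜ* (Pi C)) (β : D.GtpTheta ≃ₜ* D.GtpTheta) (hφ : ∀ g, β (phi C g) = phi C (α g))
    (hA : ∀ a : D.GtpTheta, a ∈ D.lDeltaTheta l → β a ∈ D.lDeltaTheta l)
    (hH : ∀ x, x ∈ PiYdd C ↔ α x ∈ PiYdd C)
    (hαγ : C.toLZ (α γ) = Multiplicative.ofAdd (-1))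
    (hιsign : ∃ κ' : ContH1 (phi C) (D.lDeltaTheta l) (PiYdd C ⊓ ⊤), IsOfFinOrder κ' ∧
      h1TopAut (phi C) (D.lDeltaTheta l) (PiYdd C) α β hφ hA hH (rootLiftClass C) = rootLiftClass C * κ')
    (ρ : (coh C).H1 ⊤ ≃+ (coh C).H1 ⊤)
    (hρT : ∀ x, ρ ((h1Top C).symm (Additive.ofMul x)) =
      (h1Top C).symm (Additive.ofMul (h1TopAut (phi C) (D.lDeltaTheta l) (PiYdd C) α β hφ hA hH x)))
    (n : ℤ) :
    IsOfFinAddOrder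
      (ρ ((h1Top C).symm (Additive.ofMul (ContH1.conj (phi C) (D.lDeltaTheta l) (γ ^ n) (rootLiftClass C)))) -
        (h1Top C).symm (Additive.ofMul (ContH1.conj (phi C) (D.lDeltaTheta l) (γ ^ (-n)) (rootLiftClass C)))) := by
  rw [hρT, ← map_sub, ← ofMul_div, div_eq_mul_inv]
  exact ((h1Top C).symm.toAddMonoidHom).isOfFinAddOrder
    ((isOfFinAddOrder_ofMul_iff).mpr
      (iota_reverses_translates C hS γ ε hγ hε₁ hε₂ hsign α β hφ hA hH hαγ hιsign n))

/-! ## v2 (append-only): `ι` STABILISES the orbit (hypothesis `horbit` at the model) -/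

/-- **`horbit` of `prop22_ii'_of_translates` at the model** ("`ι` stabilises the `(l·ℤ × μ_2)`-orbit
`η̈^{Θ,l·ℤ×μ_2}`", the functoriality of the Prop. 1.4 algorithm under `ι`; [IUTchII] Prop. 2.2 (ii) p. 66 over [EtTh]
Def. 2.7 p. 41): for an automorphism pair `(α, β)` as above and any `ρ` on `coh.H1 ⊤` intertwining `ρ₀ := h1TopAut`
through `h1Top` (`hρT`), IF `ρ₀` carries the root class INTO its `Π^tp_X̲̲`-orbit (`hroot : ρ₀ η̲̈ = τ₀·η̲̈` — at the
model `τ₀ = ε`: "`Θ̈(Ü) = −Θ̈(Ü⁻¹)`", [EtTh] Prop. 1.4 (ii) at the class level, an INPUT), THEN `ρ` maps `orbitOne` ONTO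
itself — by L6-t1's equivariance `ContH1Aut.autMap_conj` (`ρ₀(σ·η̲̈) = (ασ)·ρ₀(η̲̈) = (ασ·τ₀)·η̲̈`).
[claim: Mochizuki2012, status: disputed] (IUTchII §2 Prop 2.2 (ii), kurims p.66) -/
theorem horbit_of_transport (hC : D.Compat) (α : (Pi C) ≃ₜ* (Pi C)) (β : D.GtpTheta ≃ₜ* D.GtpTheta)
    (hφ : ∀ g, β (phi C g) = phi C (α g)) (hA : ∀ a : D.GtpTheta, a ∈ D.lDeltaTheta l → β a ∈ D.lDeltaTheta l)
    (hH : ∀ x, x ∈ PiYdd C ↔ α x ∈ PiYdd C)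
    (ρ : (coh C).H1 ⊤ ≃+ (coh C).H1 ⊤)
    (hρT : ∀ x, ρ ((h1Top C).symm (Additive.ofMul x)) =
      (h1Top C).symm (Additive.ofMul (h1TopAut (phi C) (D.lDeltaTheta l) (PiYdd C) α β hφ hA hH x)))
    (hroot : ∃ τ₀ : Pi C, h1TopAut (phi C) (D.lDeltaTheta l) (PiYdd C) α β hφ hA hH (rootLiftClass C) =
      ContH1.conj (phi C) (D.lDeltaTheta l) τ₀ (rootLiftClass C)) :
    ρ '' orbitOne C hC = orbitOne C hC := by
  obtain ⟨τ₀, hτ₀⟩ := hroot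
  -- `ρ` of the `σ`-conjugate is the `(α σ · τ₀)`-conjugate
  have key : ∀ σ : Pi C,
      ρ ((h1Top C).symm (Additive.ofMul (ContH1.conj (phi C) (D.lDeltaTheta l) σ (rootLiftClass C)))) =
        (h1Top C).symm (Additive.ofMul
          (ContH1.conj (phi C) (D.lDeltaTheta l) (α σ * τ₀) (rootLiftClass C))) := by
    intro σ
    rw [hρT, ContH1.conj_mul_apply, ← hτ₀]
    exact congrArg _ (congrArg _
      (ContH1Aut.autMap_conj (phi C) (D.lDeltaTheta l) α β hφ hA _ σ (rootLiftClass C)))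
  ext o
  constructor
  · rintro ⟨_, ⟨σ, rfl⟩, rfl⟩
    exact ⟨α σ * τ₀, key σ⟩
  · rintro ⟨σ, rfl⟩
    refine ⟨(h1Top C).symm (Additive.ofMul
      (ContH1.conj (phi C) (D.lDeltaTheta l) (α.symm (σ * τ₀⁻¹)) (rootLiftClass C))),
      ⟨α.symm (σ * τ₀⁻¹), rfl⟩, ?_⟩
    rw [key, ContinuousMulEquiv.apply_symm_apply, inv_mul_cancel_right]

end

end Literature.IUT.HodgeArakelov
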